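import Summits.QuantumFields.BalabanUV.T4Continuum.Support.SliceFrameGap
import Summits.QuantumFields.BalabanUV.T4Continuum.Support.VariationalColourTaxiTowerLeaves

/-!
# T⁴ programme, spine node NE2 (U1a), lane P2 — THE COMPOSITE TAXI FRAMES vs THE STRAIGHT TAXI OF THE COMPOSITE TORUS: pointwise distance, the in-block mismatch
# class of the composite frames, and the slice gap between the two gauge fixings (item «ONE-MIN AT TAXI DATA — THE COMPOSITE-FIBRE ↔ TAXI-FRAME BRIDGE», file 2;
# model level; cell `pub-balaban`)

NE2 formalisation swarm `b2b-balaban-t4-ne2-formalise-*`, leaf prover 04 GEN 7 (`prover-b2b-balaban-t4-ne2-formalise-leaf-04-g7-0`); register row «P2-sup» of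
`t4/formal/NE2/LEAVES.md`; journal CLAIMS.log INTENT 2026-08-20 l.21025.  On top of this lineage's gen 4 ∕ gen 6 files BY NAME: `VariationalColourTaxiTowerMerge.
outer_mul_inner_sub_mergedAcc_le` (coarse taxi ∘ fine taxi = merged taxi ± `d²·L(n−1)(L−1)·a`), `VariationalColourTaxiTowerStep.mergedAcc_eq_taxiAcc` (the merged taxi
IS the straight taxi of the composite torus), `VariationalColourTaxiLines.{inBlock_defect_taxiTv_adjoint_le, hcross_taxiTv_le}`, `VariationalColourTaxiTowerLeaves.
inBlock_blockOf_of_bpt`, `SliceFrameGap.{sliceFrames_close, divControl_transfer}`, `DivControlOfSliceClose.norm_starProjection_le_of_oneSided'`, and the tree's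
`B5Composition116.{sites, J, JEquiv, bpt_bpt}`, `B5Blocks16.{blockOf_bpt, bpt_bijective}`.

WHY.  At Bałaban's taxi data the (ONE-min) supplier (leaf-01-g8∕g9) gauge-fixes the fine level with the COMPOSITE frames `compTv (taxiTv n M C) (taxiTv L (fine n M) S)`
(`C = coarseTv S` the coarse bonds, `S` the one-step bonds; file 1 `ProjGRelabel.projG_compKer_eq` identifies its functional as `projG (Rtrv S) (ker Q_{compTv})`
pulled back), the vector END (parts 6–8) with the STRAIGHT taxi `taxiTv (n·L) M (Rtrv S)` of the composite torus.  This file measures the two frame fields against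
each other and feeds gen 6's `SliceFrameGap`.

THE STATEMENTS ([folklore]; OURS; `E` normed for §1, a Hilbert space `H` from §2 on; one-step bonds `S` contractive ∕ unitary with plaquette defect `≤ a`, coarse
bonds `C := coarseTv L (fine n M) S` with plaquette defect `≤ a_C` where needed):
 * §1 **`taxiTv_Rtrv_sub_compTv_le`**: `‖taxiTv (n·L) M (Rtrv S) x − compTv n L M (taxiTv n M C) (taxiTv L (fine n M) S) x‖ ≤ d·(d·(L(n−1)(L−1)·a))` at EVERY site
   (`bpt_bijective` + `bpt_bpt` + `taxiTv_bpt` + the two gen-4 lemmas) — the `τ` of `SliceFrameGap`; `plaq_Rtrv_le` (the transported bonds keep the plaquette class).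
 * §2 **`inBlock_defect_compTv_le`** (`bpt` form) ∕ **`inBlock_defect_compTv_blockOf`** (`blockOf` form, `1 < M_μ`): the in-block mismatch of the composite frames
   w.r.t. `Rtrv S` is `≤ (d−1)(L−1)(2L−1)·a + (d−1)(n−1)·a_C` (same `L`-block: the one-step taxi's own defect `(d−1)(L−1)a ≤ …`; adjacent `L`-blocks of one
   `n·L`-block: the face term `hcross_taxiTv_le` + the level-`n` taxi's own in-block defect, conjugated by the unitary `T′(x)`); `inBlock_defect_taxiTv_Rtrv_blockOf`
   (the straight taxi's class `(d−1)(n·L−1)·a`, `blockOf` form).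
 * §3 **`projG_le_of_sliceClose_param`** (any `R`, `K₁`, `K₂`, `u > 0`): `projG R K₁ W ≤ (1+u)·projG R K₂ W + (1+u⁻¹)δ²·divSq_R W` from the one-sided closeness —
   the parametric form of gen 6's `projG_le_of_sliceClose` (whose factor 2 is too coarse for a (ONE-min) main term).
 * §4 AT COMPOSITE-TAXI DATA (`R := Rtrv S`, `T_tx := taxiTv (n·L) M R`, `T_cp := compTv …`, `δ := 4·d(d(L(n−1)(L−1)a))·revPC`): **`sliceClose_taxi_comp`** ∕
   **`sliceClose_comp_taxi`** (the two one-sided closenesses, each under the `2d((nL)·w)² ≤ ½` smallness of the SOURCE frames), **`projG_taxi_le_comp`** ∕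
   **`projG_comp_le_taxi`** (§3 at these data) and **`divControl_comp_of_taxi`** ((GF3) for the composite-frame kernel from (GF3) for the straight-taxi kernel,
   constants `(4C_D + 2, 2C_D′)`, ANY average `Q`).
NOT HERE: the identification with the two-step torus (file 1), the (ONE-min) bookkeeping (file 3), the tower classes (file 4).

HONEST FRAMING (T4-DAG p. 1).  Rung (B)+1 only — NOT infinite volume, NOT a mass gap, NOT Clay.  NE2 NOT IN PRINT, NOT proved here.  MODEL LEVEL (c5): bond ∕ site
operators DATA, taxi contours and both gauge fixings OURS ([Balaban1985BackgroundPropagators] (3.19) SHAPE only); [folklore] ordered-product bookkeeping; thresholds via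
`revPC = 4d·36^d(1+nw)²` quantitatively void (memo GF3COV §3); nothing printed is a hypothesis; no `def`, no `def … : Prop`, no `sorry`; axioms standard.  V-END with
background ∕ NE2 NOT proved; NE3 OPEN; spine PROVED 0∕9 unchanged.  HONEST DEPENDENCY (cell, verbatim): continuum YM on T⁴ ⇐ BetaPertH ∧ nine spine estimates (0/9
proved); BetaPertH ⇐ (D1) ∧ (D4) ∧ CAP+tail; G-an2-4 gates asym, D1 and NE2/3/4.
-/

noncomputable section

namespace Summit.QuantumFields.BalabanUV.T4Continuum.CompositeTaxiFrameGap

open Finset WithLp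
open Literature.MathematicalPhysics.QuantumFieldTheory.Balaban1983to89
open Literature.MathematicalPhysics.QuantumFieldTheory.Balaban1983to89.B5Prop11Plancherel (Tor fine unitVec)
open Literature.MathematicalPhysics.QuantumFieldTheory.Balaban1983to89.B5Block118 (tstep tstep_zero tstep_succ bpt)
open Literature.MathematicalPhysics.QuantumFieldTheory.Balaban1983to89.B5Blocks16 (blockOf blockOf_bpt bpt_bijective)
open Literature.MathematicalPhysics.QuantumFieldTheory.Balaban1983to89.B5Composition116 (sites J JEquiv JEquiv_apply J_val bpt_bpt)
open Summit.QuantumFields.BalabanUV.T4Continuum.VariationalTower (sites_unitVec)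
open Summit.QuantumFields.BalabanUV.T4Continuum.VariationalCovariantTower (sites_add)
open Summit.QuantumFields.BalabanUV.T4Continuum.ScalarBlockTrialFunction (bpt_add_unitVec_of_eq)
open Summit.QuantumFields.BalabanUV.T4Continuum.VariationalColourFederbush (norm_le_one_of_mem_unitary)
open Summit.QuantumFields.BalabanUV.T4Continuum.VariationalColourTower (compTv Rtrv compTv_mem_unitary)
open Summit.QuantumFields.BalabanUV.T4Continuum.VariationalColourTaxiTransport
open Summit.QuantumFields.BalabanUV.T4Continuum.VariationalVectorWeitzenbock (divV divSq divSq_nonneg)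
open Summit.QuantumFields.BalabanUV.T4Continuum.VariationalVectorForm (ScV)
open Summit.QuantumFields.BalabanUV.T4Continuum.VectorBlockTrialForm (nsqV)
open Summit.QuantumFields.BalabanUV.T4Continuum.VariationalVectorGaugeSlice (avgOp sliceSub projG projG_nonneg norm_toLp_sq)
open Summit.QuantumFields.BalabanUV.T4Continuum.CovariantBlockReversePoincare (revPC revPC_nonneg)
open Summit.QuantumFields.BalabanUV.T4Continuum.DivControlOfSliceClose (norm_starProjection_le_of_oneSided')
open Summit.QuantumFields.BalabanUV.T4Continuum.SliceFrameGap (sliceFrames_close divControl_transfer)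

variable {d : ℕ} {E : Type*} [NormedAddCommGroup E] [NormedSpace ℂ E]
variable (n L : ℕ) [NeZero n] [NeZero L] (M : Fin d → ℕ) [hM : ∀ μ, NeZero (M μ)]

/-! ## §1 The straight taxi of the composite torus against the composite taxi frames -/

section Distance

omit [NeZero n] [NeZero L] hM in
/-- every block offset of the composite block is a pair (outer offset, inner offset): `Jx = J j₂ j₁`. [folklore] -/
theorem exists_J_eq (Jx : Fin d → Fin (n * L)) : ∃ (j₂ : Fin d → Fin n) (j₁ : Fin d → Fin L), Jx = J n L j₂ j₁ :=
  ⟨((JEquiv n L).symm Jx).1, ((JEquiv n L).symm Jx).2, ((JEquiv n L).apply_symm_apply Jx).symm⟩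

omit [NeZero n] [NeZero L] hM in
/-- the transported bonds keep the plaquette class of the one-step bonds. [folklore] -/
theorem plaq_Rtrv_le {S : Tor (fine L (fine n M)) → Fin d → (E →L[ℂ] E)} {a : ℝ}
    (ha : ∀ x κ ι, ‖S x κ * S (x + unitVec (fine L (fine n M)) κ) ι - S x ι * S (x + unitVec (fine L (fine n M)) ι) κ‖ ≤ a)
    (x : Tor (fine (n * L) M)) (κ ι : Fin d) :
    ‖Rtrv n L M S x κ * Rtrv n L M S (x + unitVec (fine (n * L) M) κ) ι - Rtrv n L M S x ι * Rtrv n L M S (x + unitVec (fine (n * L) M) ι) κ‖ ≤ a := by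
  simp only [Rtrv, sites_add, sites_unitVec]
  exact ha _ κ ι

omit [NeZero n] [NeZero L] hM in
/-- unitary one-step bonds give unitary transported bonds. [folklore] -/
theorem Rtrv_mem_unitary_of {H : Type*} [NormedAddCommGroup H] [InnerProductSpace ℂ H] [CompleteSpace H]
    {S : Tor (fine L (fine n M)) → Fin d → (H →L[ℂ] H)} (hU : ∀ x μ, S x μ ∈ unitary (H →L[ℂ] H)) (x : Tor (fine (n * L) M)) (μ : Fin d) :
    Rtrv n L M S x μ ∈ unitary (H →L[ℂ] H) := by
  unfold Rtrv; exact hU _ μ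

variable {S : Tor (fine L (fine n M)) → Fin d → (E →L[ℂ] E)} (hS : ∀ x μ, ‖S x μ‖ ≤ 1) {a : ℝ}
  (ha : ∀ x κ ι, ‖S x κ * S (x + unitVec (fine L (fine n M)) κ) ι - S x ι * S (x + unitVec (fine L (fine n M)) ι) κ‖ ≤ a)
include hS ha

/-- **THE STRAIGHT TAXI OF THE COMPOSITE TORUS IS `d²·L(n−1)(L−1)·a`-CLOSE TO THE COMPOSITE TAXI FRAMES**, at every site:
`‖taxiTv (n·L) M (Rtrv S) x − (taxiTv n M (coarseTv S))(block of sites x) ∘ (taxiTv L (fine n M) S)(sites x)‖ ≤ d·(d·(L(n−1)(L−1)·a))`. [folklore] -/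
theorem taxiTv_Rtrv_sub_compTv_le (x : Tor (fine (n * L) M)) :
    ‖taxiTv (n * L) M (Rtrv n L M S) x - compTv n L M (taxiTv n M (coarseTv L (fine n M) S)) (taxiTv L (fine n M) S) x‖
      ≤ (d : ℝ) * ((d : ℝ) * (((L : ℝ) * ((n - 1 : ℕ) : ℝ) * ((L - 1 : ℕ) : ℝ)) * a)) := by
  obtain ⟨⟨y, Jx⟩, rfl⟩ := (bpt_bijective (n * L) M).2 x
  obtain ⟨j₂, j₁, rfl⟩ := exists_J_eq n L Jx
  have hsite : sites n L M (bpt (n * L) M y (J n L j₂ j₁)) = bpt L (fine n M) (bpt n M y j₂) j₁ := (bpt_bpt n L M y j₂ j₁).symm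
  simp only [compTv, hsite, blockOf_bpt, taxiTv_bpt]
  rw [← mergedAcc_eq_taxiAcc L n M S y j₂ j₁ d, norm_sub_rev]
  exact outer_mul_inner_sub_mergedAcc_le L n M hS ha y j₂ j₁

end Distance

/-! ## §2 The in-block mismatch class of the composite frames -/

section Mismatch

variable {H : Type*} [NormedAddCommGroup H] [InnerProductSpace ℂ H] [CompleteSpace H]
variable {S : Tor (fine L (fine n M)) → Fin d → (H →L[ℂ] H)} (hU : ∀ x μ, S x μ ∈ unitary (H →L[ℂ] H)) {a aC : ℝ}
  (ha : ∀ x κ ι, ‖S x κ * S (x + unitVec (fine L (fine n M)) κ) ι - S x ι * S (x + unitVec (fine L (fine n M)) ι) κ‖ ≤ a)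
  (haC : ∀ y κ ι, ‖coarseTv L (fine n M) S y κ * coarseTv L (fine n M) S (y + unitVec (fine n M) κ) ι
    - coarseTv L (fine n M) S y ι * coarseTv L (fine n M) S (y + unitVec (fine n M) ι) κ‖ ≤ aC)
include hU ha

include haC in
/-- **THE IN-BLOCK MISMATCH OF THE COMPOSITE FRAMES** (`bpt` form): for `J_μ + 1 < n·L`, with `R := Rtrv S`, `T₂ := compTv (taxiTv n M C) (taxiTv L (fine n M) S)`,
`C := coarseTv S` (plaquette `≤ a_C`): `‖R(x,μ) ∘ T₂(x+e_μ)⋆ ∘ T₂(x) − 1‖ ≤ (d−1)(L−1)(2L−1)·a + (d−1)(n−1)·a_C` at `x = bpt (n·L) M y J`. [folklore] -/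
theorem inBlock_defect_compTv_le (y : Tor M) (Jx : Fin d → Fin (n * L)) (μ : Fin d) (hJ : (Jx μ : ℕ) + 1 < n * L) :
    ‖Rtrv n L M S (bpt (n * L) M y Jx) μ
        * star (compTv n L M (taxiTv n M (coarseTv L (fine n M) S)) (taxiTv L (fine n M) S) (bpt (n * L) M y Jx + unitVec (fine (n * L) M) μ))
        * compTv n L M (taxiTv n M (coarseTv L (fine n M) S)) (taxiTv L (fine n M) S) (bpt (n * L) M y Jx) - 1‖
      ≤ ((d - 1 : ℕ) : ℝ) * ((L - 1 : ℕ) : ℝ) * ((2 * L - 1 : ℕ) : ℝ) * a + ((d - 1 : ℕ) : ℝ) * ((n - 1 : ℕ) : ℝ) * aC := by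
  obtain ⟨j₂, j₁, rfl⟩ := exists_J_eq n L Jx
  have ha0 : 0 ≤ a := (norm_nonneg _).trans (ha 0 μ μ)
  have haC0 : 0 ≤ aC := (norm_nonneg _).trans (haC 0 μ μ)
  have hUC : ∀ y μ, coarseTv L (fine n M) S y μ ∈ unitary (H →L[ℂ] H) := coarseTv_mem_unitary L (fine n M) hU
  set C := coarseTv L (fine n M) S with hC
  set b := bpt n M y j₂ with hb
  set x' := bpt L (fine n M) b j₁ with hx'
  have hsite : sites n L M (bpt (n * L) M y (J n L j₂ j₁)) = x' := (bpt_bpt n L M y j₂ j₁).symm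
  have hsite' : sites n L M (bpt (n * L) M y (J n L j₂ j₁) + unitVec (fine (n * L) M) μ) = x' + unitVec (fine L (fine n M)) μ := by
    rw [sites_add, sites_unitVec, hsite]
  have hT'u : ∀ z, taxiTv L (fine n M) S z ∈ unitary (H →L[ℂ] H) := taxiTv_mem_unitary L (fine n M) hU
  have hTu : ∀ z, taxiTv n M C z ∈ unitary (H →L[ℂ] H) := taxiTv_mem_unitary n M hUC
  have hT'1 : ∀ z, ‖taxiTv L (fine n M) S z‖ ≤ 1 := fun z => norm_le_one_of_mem_unitary (hT'u z)
  have hT1 : ∀ z, ‖taxiTv n M C z‖ ≤ 1 := fun z => norm_le_one_of_mem_unitary (hTu z)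
  have h1 : 0 ≤ ((d - 1 : ℕ) : ℝ) * ((L - 1 : ℕ) : ℝ) * ((2 * L - 1 : ℕ) : ℝ) * a := by positivity
  have h2 : 0 ≤ ((d - 1 : ℕ) : ℝ) * ((n - 1 : ℕ) : ℝ) * aC := by positivity
  simp only [compTv, Rtrv, hsite, hsite']
  by_cases hj : (j₁ μ : ℕ) + 1 < L
  · -- same `L`-block: the outer frame cancels
    have hblk : blockOf L (fine n M) (x' + unitVec (fine L (fine n M)) μ) = b := by
      rw [hx', show unitVec (fine L (fine n M)) μ = tstep (fine L (fine n M)) μ 1 by rw [tstep_succ, tstep_zero, zero_add],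
        ← bpt_update_add L (fine n M) b j₁ μ (s := 1) hj, blockOf_bpt]
    rw [hblk, hx', blockOf_bpt, ← hx']
    have e : S x' μ * star (taxiTv n M C b * taxiTv L (fine n M) S (x' + unitVec (fine L (fine n M)) μ)) * (taxiTv n M C b * taxiTv L (fine n M) S x')
        = S x' μ * star (taxiTv L (fine n M) S (x' + unitVec (fine L (fine n M)) μ)) * (star (taxiTv n M C b) * taxiTv n M C b) * taxiTv L (fine n M) S x' := by
      rw [star_mul]; noncomm_ring
    rw [e, Unitary.star_mul_self_of_mem (hTu b), mul_one, hx']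
    have hL1 : (1 : ℝ) ≤ ((2 * L - 1 : ℕ) : ℝ) := by
      have := NeZero.pos L
      exact_mod_cast (by omega : 1 ≤ 2 * L - 1)
    have h0 : 0 ≤ ((d - 1 : ℕ) : ℝ) * ((L - 1 : ℕ) : ℝ) * a := by positivity
    refine (inBlock_defect_taxiTv_adjoint_le L (fine n M) hU ha b j₁ μ hj).trans ?_
    nlinarith [mul_le_mul_of_nonneg_left hL1 h0, h2]
  · -- adjacent `L`-blocks inside one `n·L`-block: face term + the level-`n` taxi's own in-block defect
    have hjL : (j₁ μ : ℕ) + 1 = L := by have := (j₁ μ).is_lt; omega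
    have hj₂ : (j₂ μ : ℕ) + 1 < n := by
      by_contra hc
      have hge : n ≤ (j₂ μ : ℕ) + 1 := by omega
      have hv := J_val n L j₂ j₁ μ
      have hm := Nat.mul_le_mul_right L hge
      nlinarith [hv, hjL, hm, hJ]
    have hface : x' + unitVec (fine L (fine n M)) μ = bpt L (fine n M) (b + unitVec (fine n M) μ) (Function.update j₁ μ 0) :=
      bpt_add_unitVec_of_eq L (fine n M) b j₁ μ hjL
    have hblk : blockOf L (fine n M) (x' + unitVec (fine L (fine n M)) μ) = b + unitVec (fine n M) μ := by rw [hface, blockOf_bpt]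
    rw [hblk, hx', blockOf_bpt, ← hx']
    set U := S x' μ
    set T₁' := taxiTv L (fine n M) S (x' + unitVec (fine L (fine n M)) μ)
    set T₀' := taxiTv L (fine n M) S x'
    set Tb1 := taxiTv n M C (b + unitVec (fine n M) μ)
    set Tb := taxiTv n M C b
    have hcross : ‖U * star T₁' - star T₀' * C b μ‖ ≤ ((d - 1 : ℕ) : ℝ) * ((L - 1 : ℕ) : ℝ) * ((2 * L - 1 : ℕ) : ℝ) * a :=
      hcross_taxiTv_le L (fine n M) hU ha b j₁ μ hjL
    have hin : ‖C b μ * star Tb1 * Tb - 1‖ ≤ ((d - 1 : ℕ) : ℝ) * ((n - 1 : ℕ) : ℝ) * aC := by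
      have h := inBlock_defect_taxiTv_adjoint_le n M hUC haC y j₂ μ hj₂
      rw [← hb] at h
      exact h
    have hT₀'1 : star T₀' * T₀' = 1 := Unitary.star_mul_self_of_mem (hT'u x')
    have e : U * star (Tb1 * T₁') * (Tb * T₀') - 1
        = (U * star T₁' - star T₀' * C b μ) * (star Tb1 * Tb * T₀') + star T₀' * (C b μ * star Tb1 * Tb - 1) * T₀' := by
      rw [star_mul]
      have : star T₀' * (C b μ * star Tb1 * Tb - 1) * T₀' = star T₀' * (C b μ * star Tb1 * Tb) * T₀' - star T₀' * T₀' := by noncomm_ring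
      rw [this, hT₀'1]
      noncomm_ring
    rw [e]
    have n1 : ‖star Tb1 * Tb * T₀'‖ ≤ 1 :=
      (norm_mul_le _ _).trans (mul_le_one₀ ((norm_mul_le _ _).trans
        (mul_le_one₀ (by rw [norm_star]; exact hT1 _) (norm_nonneg _) (hT1 b))) (norm_nonneg _) (hT'1 x'))
    have n2 : ‖star T₀' * (C b μ * star Tb1 * Tb - 1) * T₀'‖ ≤ ((d - 1 : ℕ) : ℝ) * ((n - 1 : ℕ) : ℝ) * aC := by
      calc ‖star T₀' * (C b μ * star Tb1 * Tb - 1) * T₀'‖ ≤ ‖star T₀' * (C b μ * star Tb1 * Tb - 1)‖ * ‖T₀'‖ := norm_mul_le _ _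
        _ ≤ (‖star T₀'‖ * ‖C b μ * star Tb1 * Tb - 1‖) * 1 := mul_le_mul (norm_mul_le _ _) (hT'1 x') (norm_nonneg _) (by positivity)
        _ ≤ (1 * ‖C b μ * star Tb1 * Tb - 1‖) * 1 := by gcongr; rw [norm_star]; exact hT'1 x'
        _ = ‖C b μ * star Tb1 * Tb - 1‖ := by ring
        _ ≤ _ := hin
    have n3 : ‖(U * star T₁' - star T₀' * C b μ) * (star Tb1 * Tb * T₀')‖ ≤ ((d - 1 : ℕ) : ℝ) * ((L - 1 : ℕ) : ℝ) * ((2 * L - 1 : ℕ) : ℝ) * a := by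
      calc ‖(U * star T₁' - star T₀' * C b μ) * (star Tb1 * Tb * T₀')‖ ≤ ‖U * star T₁' - star T₀' * C b μ‖ * ‖star Tb1 * Tb * T₀'‖ := norm_mul_le _ _
        _ ≤ (((d - 1 : ℕ) : ℝ) * ((L - 1 : ℕ) : ℝ) * ((2 * L - 1 : ℕ) : ℝ) * a) * 1 := mul_le_mul hcross n1 (norm_nonneg _) h1
        _ = _ := mul_one _
    exact (norm_add_le _ _).trans (add_le_add n3 n2)

include haC in
/-- the same in `blockOf` form (`1 < M_μ`: the wrap-around of the unit lattice is honest). [folklore] -/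
theorem inBlock_defect_compTv_blockOf (hM2 : ∀ μ, 1 < M μ) (x : Tor (fine (n * L) M)) (μ : Fin d)
    (hx : blockOf (n * L) M (x + unitVec (fine (n * L) M) μ) = blockOf (n * L) M x) :
    ‖Rtrv n L M S x μ
        * star (compTv n L M (taxiTv n M (coarseTv L (fine n M) S)) (taxiTv L (fine n M) S) (x + unitVec (fine (n * L) M) μ))
        * compTv n L M (taxiTv n M (coarseTv L (fine n M) S)) (taxiTv L (fine n M) S) x - 1‖
      ≤ ((d - 1 : ℕ) : ℝ) * ((L - 1 : ℕ) : ℝ) * ((2 * L - 1 : ℕ) : ℝ) * a + ((d - 1 : ℕ) : ℝ) * ((n - 1 : ℕ) : ℝ) * aC :=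
  inBlock_blockOf_of_bpt (n * L) M hM2
    (P := fun x μ => ‖Rtrv n L M S x μ
        * star (compTv n L M (taxiTv n M (coarseTv L (fine n M) S)) (taxiTv L (fine n M) S) (x + unitVec (fine (n * L) M) μ))
        * compTv n L M (taxiTv n M (coarseTv L (fine n M) S)) (taxiTv L (fine n M) S) x - 1‖
      ≤ ((d - 1 : ℕ) : ℝ) * ((L - 1 : ℕ) : ℝ) * ((2 * L - 1 : ℕ) : ℝ) * a + ((d - 1 : ℕ) : ℝ) * ((n - 1 : ℕ) : ℝ) * aC)
    (fun y Jx μ hJ => inBlock_defect_compTv_le n L M hU ha haC y Jx μ hJ) x μ hx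

/-- the straight taxi of the composite torus: in-block mismatch `≤ (d−1)(n·L−1)·a`, `blockOf` form. [folklore] -/
theorem inBlock_defect_taxiTv_Rtrv_blockOf (hM2 : ∀ μ, 1 < M μ) (x : Tor (fine (n * L) M)) (μ : Fin d)
    (hx : blockOf (n * L) M (x + unitVec (fine (n * L) M) μ) = blockOf (n * L) M x) :
    ‖Rtrv n L M S x μ * star (taxiTv (n * L) M (Rtrv n L M S) (x + unitVec (fine (n * L) M) μ)) * taxiTv (n * L) M (Rtrv n L M S) x - 1‖
      ≤ ((d - 1 : ℕ) : ℝ) * ((n * L - 1 : ℕ) : ℝ) * a :=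
  inBlock_blockOf_of_bpt (n * L) M hM2
    (P := fun x μ => ‖Rtrv n L M S x μ * star (taxiTv (n * L) M (Rtrv n L M S) (x + unitVec (fine (n * L) M) μ)) * taxiTv (n * L) M (Rtrv n L M S) x - 1‖
      ≤ ((d - 1 : ℕ) : ℝ) * ((n * L - 1 : ℕ) : ℝ) * a)
    (fun y Jx μ hJ => inBlock_defect_taxiTv_adjoint_le (n * L) M (Rtrv_mem_unitary_of n L M hU) (plaq_Rtrv_le n L M ha) y Jx μ hJ) x μ hx

end Mismatch

/-! ## §3 The parametric comparison of two projected functionals along a one-sided slice closeness -/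

section Param

variable {H : Type*} [NormedAddCommGroup H] [InnerProductSpace ℂ H] [CompleteSpace H] [FiniteDimensional ℂ H]
variable {N : Fin d → ℕ} [∀ μ, NeZero (N μ)]

omit [NeZero n] [NeZero L] hM in
/-- **`projG R K₁ W ≤ (1+u)·projG R K₂ W + (1+u⁻¹)δ²·divSq_R W`** for every `u > 0`, from `∀ y ∈ S_R(K₁), ‖y − Π_{S_R(K₂)} y‖ ≤ δ‖y‖` (`0 ≤ δ`). [folklore] -/
theorem projG_le_of_sliceClose_param (R : Tor N → Fin d → (H →L[ℂ] H)) (K₁ K₂ : Submodule ℂ (Tor N → H)) {δ : ℝ} (hδ0 : 0 ≤ δ)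
    (hclose : ∀ y ∈ sliceSub N R K₁, ‖y - (sliceSub N R K₂).starProjection y‖ ≤ δ * ‖y‖) {u : ℝ} (hu : 0 < u) (W : Tor N → Fin d → H) :
    projG N R K₁ W ≤ (1 + u) * projG N R K₂ W + (1 + u⁻¹) * (δ ^ 2 * divSq N R W) := by
  obtain ⟨b, hb⟩ : ∃ b : PiLp 2 (fun _ : Tor N => H), b = toLp 2 (divV N R W) := ⟨_, rfl⟩
  have eD : divSq N R W = ‖b‖ ^ 2 := by rw [hb, norm_toLp_sq]; rfl
  have eG₁ : projG N R K₁ W = ‖(sliceSub N R K₁).starProjection b‖ ^ 2 := by rw [hb]; rfl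
  have eG₂ : projG N R K₂ W = ‖(sliceSub N R K₂).starProjection b‖ ^ 2 := by rw [hb]; rfl
  have f1 : ‖(sliceSub N R K₁).starProjection b‖ ≤ ‖(sliceSub N R K₂).starProjection b‖ + δ * ‖b‖ :=
    norm_starProjection_le_of_oneSided' _ _ hδ0 hclose b
  rw [eG₁, eG₂, eD]
  set p := ‖(sliceSub N R K₂).starProjection b‖
  set q := δ * ‖b‖
  have hp : 0 ≤ p := norm_nonneg _
  have hq : 0 ≤ q := by positivity
  have hsq := pow_le_pow_left₀ (norm_nonneg _) f1 2
  -- Young: `2pq ≤ u p² + u⁻¹ q²`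
  have hy : 2 * p * q ≤ u * p ^ 2 + u⁻¹ * q ^ 2 := by
    have h := sq_nonneg (Real.sqrt u * p - Real.sqrt u⁻¹ * q)
    have hsu : Real.sqrt u ^ 2 = u := Real.sq_sqrt hu.le
    have hsu' : Real.sqrt u⁻¹ ^ 2 = u⁻¹ := Real.sq_sqrt (inv_nonneg.mpr hu.le)
    have hprod : Real.sqrt u * Real.sqrt u⁻¹ = 1 := by
      rw [← Real.sqrt_mul hu.le, mul_inv_cancel₀ hu.ne', Real.sqrt_one]
    nlinarith [h, hsu, hsu', hprod]
  have hx : (p + q) ^ 2 ≤ (1 + u) * p ^ 2 + (1 + u⁻¹) * q ^ 2 := by nlinarith [hy]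
  rw [mul_pow] at hx
  linarith [hsq, hx]

end Param

/-! ## §4 At composite-taxi data: the two slice closenesses, the two functional comparisons, the (GF3) transfer -/

section Data

variable {H : Type*} [NormedAddCommGroup H] [InnerProductSpace ℂ H] [CompleteSpace H] [FiniteDimensional ℂ H]
variable {S : Tor (fine L (fine n M)) → Fin d → (H →L[ℂ] H)} (hU : ∀ x μ, S x μ ∈ unitary (H →L[ℂ] H)) {a aC : ℝ}
  (ha : ∀ x κ ι, ‖S x κ * S (x + unitVec (fine L (fine n M)) κ) ι - S x ι * S (x + unitVec (fine L (fine n M)) ι) κ‖ ≤ a)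
  (haC : ∀ y κ ι, ‖coarseTv L (fine n M) S y κ * coarseTv L (fine n M) S (y + unitVec (fine n M) κ) ι
    - coarseTv L (fine n M) S y ι * coarseTv L (fine n M) S (y + unitVec (fine n M) ι) κ‖ ≤ aC)
  (hM2 : ∀ μ, 1 < M μ) (ha0 : 0 ≤ a)
include hU ha haC hM2 ha0

/-- **THE STRAIGHT-TAXI SLICE IS ONE-SIDEDLY CLOSE TO THE COMPOSITE-FRAME SLICE**: with `R := Rtrv S`, `T_tx := taxiTv (n·L) M R`, `T_cp := compTv (taxiTv n M C)
(taxiTv L (fine n M) S)`, `w_cp := (d−1)(L−1)(2L−1)a + (d−1)(n−1)a_C`, under `2d((n·L)·(d−1)(n·L−1)a)² ≤ ½`: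
`∀ y ∈ S_R(ker Q_{T_tx}), ‖y − Π_{S_R(ker Q_{T_cp})} y‖ ≤ 4·(d(d(L(n−1)(L−1)a)))·revPC d (n·L) w_cp · ‖y‖`. [folklore] -/
theorem sliceClose_taxi_comp (haC0 : 0 ≤ aC) (hsmall : 2 * (d : ℝ) * ((((n * L : ℕ) : ℝ)) * (((d - 1 : ℕ) : ℝ) * ((n * L - 1 : ℕ) : ℝ) * a)) ^ 2 ≤ 1 / 2) :
    ∀ y ∈ sliceSub (fine (n * L) M) (Rtrv n L M S) (LinearMap.ker (avgOp (n * L) M (taxiTv (n * L) M (Rtrv n L M S)))),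
      ‖y - (sliceSub (fine (n * L) M) (Rtrv n L M S)
          (LinearMap.ker (avgOp (n * L) M (compTv n L M (taxiTv n M (coarseTv L (fine n M) S)) (taxiTv L (fine n M) S))))).starProjection y‖
        ≤ (4 * ((d : ℝ) * ((d : ℝ) * (((L : ℝ) * ((n - 1 : ℕ) : ℝ) * ((L - 1 : ℕ) : ℝ)) * a)))
            * revPC d (n * L) (((d - 1 : ℕ) : ℝ) * ((L - 1 : ℕ) : ℝ) * ((2 * L - 1 : ℕ) : ℝ) * a + ((d - 1 : ℕ) : ℝ) * ((n - 1 : ℕ) : ℝ) * aC)) * ‖y‖ := by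
  have hS : ∀ x μ, ‖S x μ‖ ≤ 1 := fun x μ => norm_le_one_of_mem_unitary (hU x μ)
  have hUC := coarseTv_mem_unitary L (fine n M) hU
  have hw0 : 0 ≤ ((d - 1 : ℕ) : ℝ) * ((L - 1 : ℕ) : ℝ) * ((2 * L - 1 : ℕ) : ℝ) * a + ((d - 1 : ℕ) : ℝ) * ((n - 1 : ℕ) : ℝ) * aC := by positivity
  have h := sliceFrames_close (n * L) M (Rtrv_mem_unitary_of n L M hU) (taxiTv_mem_unitary (n * L) M (Rtrv_mem_unitary_of n L M hU))
    (compTv_mem_unitary n L M (taxiTv_mem_unitary n M hUC) (taxiTv_mem_unitary L (fine n M) hU))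
    (taxiTv_Rtrv_sub_compTv_le n L M hS ha) (inBlock_defect_taxiTv_Rtrv_blockOf n L M hU ha hM2)
    (by simpa only [Nat.cast_mul] using hsmall) hw0 (inBlock_defect_compTv_blockOf n L M hU ha haC hM2)
  simpa only [Nat.cast_mul] using h

/-- **… AND CONVERSELY** (under the smallness of the composite class `2d((n·L)·w_cp)² ≤ ½`): `∀ y ∈ S_R(ker Q_{T_cp}), ‖y − Π_{S_R(ker Q_{T_tx})} y‖ ≤
4·(d(d(L(n−1)(L−1)a)))·revPC d (n·L) ((d−1)(n·L−1)a) · ‖y‖` (`‖T_cp − T_tx‖ = ‖T_tx − T_cp‖`). [folklore] -/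
theorem sliceClose_comp_taxi
    (hsmall : 2 * (d : ℝ) * ((((n * L : ℕ) : ℝ)) * (((d - 1 : ℕ) : ℝ) * ((L - 1 : ℕ) : ℝ) * ((2 * L - 1 : ℕ) : ℝ) * a + ((d - 1 : ℕ) : ℝ) * ((n - 1 : ℕ) : ℝ) * aC)) ^ 2 ≤ 1 / 2) :
    ∀ y ∈ sliceSub (fine (n * L) M) (Rtrv n L M S)
        (LinearMap.ker (avgOp (n * L) M (compTv n L M (taxiTv n M (coarseTv L (fine n M) S)) (taxiTv L (fine n M) S)))),
      ‖y - (sliceSub (fine (n * L) M) (Rtrv n L M S) (LinearMap.ker (avgOp (n * L) M (taxiTv (n * L) M (Rtrv n L M S))))).starProjection y‖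
        ≤ (4 * ((d : ℝ) * ((d : ℝ) * (((L : ℝ) * ((n - 1 : ℕ) : ℝ) * ((L - 1 : ℕ) : ℝ)) * a)))
            * revPC d (n * L) (((d - 1 : ℕ) : ℝ) * ((n * L - 1 : ℕ) : ℝ) * a)) * ‖y‖ := by
  have hS : ∀ x μ, ‖S x μ‖ ≤ 1 := fun x μ => norm_le_one_of_mem_unitary (hU x μ)
  have hUC := coarseTv_mem_unitary L (fine n M) hU
  have hw0 : 0 ≤ ((d - 1 : ℕ) : ℝ) * ((n * L - 1 : ℕ) : ℝ) * a := by positivity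
  have hτ : ∀ x, ‖compTv n L M (taxiTv n M (coarseTv L (fine n M) S)) (taxiTv L (fine n M) S) x - taxiTv (n * L) M (Rtrv n L M S) x‖
      ≤ (d : ℝ) * ((d : ℝ) * (((L : ℝ) * ((n - 1 : ℕ) : ℝ) * ((L - 1 : ℕ) : ℝ)) * a)) := fun x => by
    rw [norm_sub_rev]; exact taxiTv_Rtrv_sub_compTv_le n L M hS ha x
  have h := sliceFrames_close (n * L) M (Rtrv_mem_unitary_of n L M hU)
    (compTv_mem_unitary n L M (taxiTv_mem_unitary n M hUC) (taxiTv_mem_unitary L (fine n M) hU))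
    (taxiTv_mem_unitary (n * L) M (Rtrv_mem_unitary_of n L M hU))
    hτ (inBlock_defect_compTv_blockOf n L M hU ha haC hM2)
    (by simpa only [Nat.cast_mul] using hsmall) hw0 (inBlock_defect_taxiTv_Rtrv_blockOf n L M hU ha hM2)
  simpa only [Nat.cast_mul] using h

/-- **THE STRAIGHT-TAXI FUNCTIONAL AGAINST THE COMPOSITE-FRAME ONE** (§3 at these data, any `u > 0`):
`projG R (ker Q_{T_tx}) W ≤ (1+u)·projG R (ker Q_{T_cp}) W + (1+u⁻¹)·δ²·divSq_R W`, `δ = 4·d(d(L(n−1)(L−1)a))·revPC d (n·L) w_cp`. [folklore] -/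
theorem projG_taxi_le_comp (haC0 : 0 ≤ aC) (hsmall : 2 * (d : ℝ) * ((((n * L : ℕ) : ℝ)) * (((d - 1 : ℕ) : ℝ) * ((n * L - 1 : ℕ) : ℝ) * a)) ^ 2 ≤ 1 / 2) {u : ℝ} (hu : 0 < u)
    (W : Tor (fine (n * L) M) → Fin d → H) :
    projG (fine (n * L) M) (Rtrv n L M S) (LinearMap.ker (avgOp (n * L) M (taxiTv (n * L) M (Rtrv n L M S)))) W
      ≤ (1 + u) * projG (fine (n * L) M) (Rtrv n L M S)
          (LinearMap.ker (avgOp (n * L) M (compTv n L M (taxiTv n M (coarseTv L (fine n M) S)) (taxiTv L (fine n M) S)))) W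
        + (1 + u⁻¹) * ((4 * ((d : ℝ) * ((d : ℝ) * (((L : ℝ) * ((n - 1 : ℕ) : ℝ) * ((L - 1 : ℕ) : ℝ)) * a)))
            * revPC d (n * L) (((d - 1 : ℕ) : ℝ) * ((L - 1 : ℕ) : ℝ) * ((2 * L - 1 : ℕ) : ℝ) * a + ((d - 1 : ℕ) : ℝ) * ((n - 1 : ℕ) : ℝ) * aC)) ^ 2
            * divSq (fine (n * L) M) (Rtrv n L M S) W) := by
  have hδ0 : 0 ≤ 4 * ((d : ℝ) * ((d : ℝ) * (((L : ℝ) * ((n - 1 : ℕ) : ℝ) * ((L - 1 : ℕ) : ℝ)) * a)))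
      * revPC d (n * L) (((d - 1 : ℕ) : ℝ) * ((L - 1 : ℕ) : ℝ) * ((2 * L - 1 : ℕ) : ℝ) * a + ((d - 1 : ℕ) : ℝ) * ((n - 1 : ℕ) : ℝ) * aC) := by
    have := revPC_nonneg (d := d) (n * L) (((d - 1 : ℕ) : ℝ) * ((L - 1 : ℕ) : ℝ) * ((2 * L - 1 : ℕ) : ℝ) * a + ((d - 1 : ℕ) : ℝ) * ((n - 1 : ℕ) : ℝ) * aC)
    positivity
  exact projG_le_of_sliceClose_param (N := fine (n * L) M) (Rtrv n L M S) _ _ hδ0 (sliceClose_taxi_comp n L M hU ha haC hM2 ha0 haC0 hsmall) hu W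

/-- **… AND THE COMPOSITE-FRAME FUNCTIONAL AGAINST THE STRAIGHT-TAXI ONE**: `projG R (ker Q_{T_cp}) W ≤ (1+u)·projG R (ker Q_{T_tx}) W + (1+u⁻¹)·δ′²·divSq_R W`,
`δ′ = 4·d(d(L(n−1)(L−1)a))·revPC d (n·L) ((d−1)(n·L−1)a)`. [folklore] -/
theorem projG_comp_le_taxi
    (hsmall : 2 * (d : ℝ) * ((((n * L : ℕ) : ℝ)) * (((d - 1 : ℕ) : ℝ) * ((L - 1 : ℕ) : ℝ) * ((2 * L - 1 : ℕ) : ℝ) * a + ((d - 1 : ℕ) : ℝ) * ((n - 1 : ℕ) : ℝ) * aC)) ^ 2 ≤ 1 / 2)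
    {u : ℝ} (hu : 0 < u) (W : Tor (fine (n * L) M) → Fin d → H) :
    projG (fine (n * L) M) (Rtrv n L M S)
        (LinearMap.ker (avgOp (n * L) M (compTv n L M (taxiTv n M (coarseTv L (fine n M) S)) (taxiTv L (fine n M) S)))) W
      ≤ (1 + u) * projG (fine (n * L) M) (Rtrv n L M S) (LinearMap.ker (avgOp (n * L) M (taxiTv (n * L) M (Rtrv n L M S)))) W
        + (1 + u⁻¹) * ((4 * ((d : ℝ) * ((d : ℝ) * (((L : ℝ) * ((n - 1 : ℕ) : ℝ) * ((L - 1 : ℕ) : ℝ)) * a)))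
            * revPC d (n * L) (((d - 1 : ℕ) : ℝ) * ((n * L - 1 : ℕ) : ℝ) * a)) ^ 2 * divSq (fine (n * L) M) (Rtrv n L M S) W) := by
  have hδ0 : 0 ≤ 4 * ((d : ℝ) * ((d : ℝ) * (((L : ℝ) * ((n - 1 : ℕ) : ℝ) * ((L - 1 : ℕ) : ℝ)) * a))) * revPC d (n * L) (((d - 1 : ℕ) : ℝ) * ((n * L - 1 : ℕ) : ℝ) * a) := by
    have := revPC_nonneg (d := d) (n * L) (((d - 1 : ℕ) : ℝ) * ((n * L - 1 : ℕ) : ℝ) * a)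
    positivity
  exact projG_le_of_sliceClose_param (N := fine (n * L) M) (Rtrv n L M S) _ _ hδ0 (sliceClose_comp_taxi n L M hU ha haC hM2 ha0 hsmall) hu W

/-- **(GF3) FOR THE COMPOSITE-FRAME KERNEL FROM (GF3) FOR THE STRAIGHT-TAXI KERNEL** (gen 6's `divControl_transfer` at these data; ANY average `Q`, lattice letters
`(n·L)^{−d}((n·L)²·divSq)`): constants `(4C_D + 2, 2C_D′)` under `4C_D·δ² ≤ 1`. [folklore] -/
theorem divControl_comp_of_taxi (haC0 : 0 ≤ aC) (hsmall : 2 * (d : ℝ) * ((((n * L : ℕ) : ℝ)) * (((d - 1 : ℕ) : ℝ) * ((n * L - 1 : ℕ) : ℝ) * a)) ^ 2 ≤ 1 / 2)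
    {Q : (Tor (fine (n * L) M) → Fin d → H) → (Tor M → Fin d → H)} {CD CD' : ℝ} (hCD : 0 ≤ CD) (hCD' : 0 ≤ CD')
    (hGdiv : ∀ W, ((((n * L : ℕ) : ℝ)) ^ d)⁻¹ * ((((n * L : ℕ) : ℝ)) ^ 2 * divSq (fine (n * L) M) (Rtrv n L M S) W)
      ≤ CD * ScV (n * L) M (Rtrv n L M S) (projG (fine (n * L) M) (Rtrv n L M S) (LinearMap.ker (avgOp (n * L) M (taxiTv (n * L) M (Rtrv n L M S))))) W
        + CD' * nsqV M (Q W))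
    (hsmallδ : 4 * CD * (4 * ((d : ℝ) * ((d : ℝ) * (((L : ℝ) * ((n - 1 : ℕ) : ℝ) * ((L - 1 : ℕ) : ℝ)) * a)))
        * revPC d (n * L) (((d - 1 : ℕ) : ℝ) * ((L - 1 : ℕ) : ℝ) * ((2 * L - 1 : ℕ) : ℝ) * a + ((d - 1 : ℕ) : ℝ) * ((n - 1 : ℕ) : ℝ) * aC)) ^ 2 ≤ 1)
    (W : Tor (fine (n * L) M) → Fin d → H) :
    ((((n * L : ℕ) : ℝ)) ^ d)⁻¹ * ((((n * L : ℕ) : ℝ)) ^ 2 * divSq (fine (n * L) M) (Rtrv n L M S) W)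
      ≤ (4 * CD + 2) * ScV (n * L) M (Rtrv n L M S) (projG (fine (n * L) M) (Rtrv n L M S)
          (LinearMap.ker (avgOp (n * L) M (compTv n L M (taxiTv n M (coarseTv L (fine n M) S)) (taxiTv L (fine n M) S))))) W
        + 2 * CD' * nsqV M (Q W) := by
  have hδ0 : 0 ≤ 4 * ((d : ℝ) * ((d : ℝ) * (((L : ℝ) * ((n - 1 : ℕ) : ℝ) * ((L - 1 : ℕ) : ℝ)) * a)))
      * revPC d (n * L) (((d - 1 : ℕ) : ℝ) * ((L - 1 : ℕ) : ℝ) * ((2 * L - 1 : ℕ) : ℝ) * a + ((d - 1 : ℕ) : ℝ) * ((n - 1 : ℕ) : ℝ) * aC) := by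
    have := revPC_nonneg (d := d) (n * L) (((d - 1 : ℕ) : ℝ) * ((L - 1 : ℕ) : ℝ) * ((2 * L - 1 : ℕ) : ℝ) * a + ((d - 1 : ℕ) : ℝ) * ((n - 1 : ℕ) : ℝ) * aC)
    positivity
  have h := divControl_transfer (n * L) M (Rtrv n L M S) _ _ (Q := Q) hCD hCD' hδ0 (fun W => by simpa only [Nat.cast_mul] using hGdiv W)
    (sliceClose_taxi_comp n L M hU ha haC hM2 ha0 haC0 hsmall) hsmallδ W
  simpa only [Nat.cast_mul] using h

end Data

end Summit.QuantumFields.BalabanUV.T4Continuum.CompositeTaxiFrameGap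

end
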